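import Summits.CriticalPhenomena.PercolationContinuityZ3.Theorems.PercNearOneGluingNoHeavyLowerTailSunflowerPendant
import Summits.CriticalPhenomena.PercolationContinuityZ3.Theorems.PercNearOneGluingNoHeavyLowerTailSunflowerUnionEdge
import Summits.CriticalPhenomena.PercolationContinuityZ3.Theorems.PercNearOneGluingNoHeavyLowerTailSunflowerSafeMinors
import HarnessLib

/-!
# `NoHeavyLowerTail` (crux stmt-CriticalPhenomena-4575), abstract sunflower cubic: ATTACHING A VERTEX — preliminaries

Support file (seat `prim-ineq-prove-1` gen 49; `--supports stmt-CriticalPhenomena-4575`).  No `sorry`, no named facts.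
Memo: run/shared/lean/prim/prim-ineq-prove-1/FINDING-PENDANT-prove1-g49.md §6.  Main theorem in `…SunflowerAttach`.

SETTING (`…SunflowerSafeCalculus`, `…SunflowerSafeMinors`).  `μ = prodBernoulli p` on `Set ι`; `Safe p A`.
This file defines, for a finite vertex set `N`:
* `Attach.hit N = {ω | ω meets N}` (an up-set, determined by `N`, `μ(hit N)ᶜ = ∏_{x∈N}(1 − p x)`);
* `Attach.delN N X = {ω | ω ∖ N ∈ X}` — the section "all of `N` closed" (determined off `N`; `μ(X) = μ(X ∩ hit N) + μ(hit N)ᶜ·μ(delN N X)`);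
* `Attach.HitSafe p N A` — HIT-CONDITIONED SAFETY: for every finite family of up-sets meeting pairwise inside `A`,
  `∏ μ(V_i ∩ hit N) ≤ μ(A ∩ hit N)^(n−1) · μ(hit N)` (Lemma A in product form under the conditional law `μ(· | ω meets N)`);
* `Attach.attachEv z N = {ω | z ∈ ω} ∩ hit N` — what attaching a new vertex `z` to `N` adds to a core, with its two sections at `z`.
-/

noncomputable section

namespace Summit.CriticalPhenomena.PercolationContinuityZ3.Theorems.SunflowerPartition

namespace SafeCalc

open MeasureTheory Finset
open Literature.Probability.LatticeModels Literature.Probability.Percolation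

variable {ι : Type*} [Fintype ι] [DecidableEq ι] (p : ι → unitInterval)

namespace Attach

/-! ## The hitting event and the `N`-deletion section -/

/-- `hit N` : the configuration meets `N`. [this work] -/
def hit (N : Finset ι) : Set (Set ι) := {ω | ∃ x ∈ N, x ∈ ω}

/-- `delN N X = {ω | ω ∖ N ∈ X}` : `X` holds with all of `N` switched off. [this work] -/
def delN (N : Finset ι) (X : Set (Set ι)) : Set (Set ι) := {ω | ω \ (↑N : Set ι) ∈ X}

omit [Fintype ι] [DecidableEq ι] in
/-- `hit N` is an up-set. [this work] -/
theorem isUpperSet_hit (N : Finset ι) : IsUpperSet (hit N) := fun _ _ hle ⟨x, hxN, hx⟩ => ⟨x, hxN, hle hx⟩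

omit [Fintype ι] [DecidableEq ι] in
/-- `delN` of an up-set is an up-set. [this work] -/
theorem isUpperSet_delN (N : Finset ι) {X : Set (Set ι)} (hX : IsUpperSet X) : IsUpperSet (delN N X) :=
  fun _ _ hle hω => hX (Set.sdiff_subset_sdiff_left hle) hω

omit [Fintype ι] [DecidableEq ι] in
/-- `delN` is monotone. [this work] -/
theorem delN_mono (N : Finset ι) {X Y : Set (Set ι)} (h : X ⊆ Y) : delN N X ⊆ delN N Y := fun _ hω => h hω

omit [Fintype ι] [DecidableEq ι] in
/-- `delN` commutes with intersections. [this work] -/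
theorem delN_inter (N : Finset ι) (X Y : Set (Set ι)) : delN N (X ∩ Y) = delN N X ∩ delN N Y := rfl

omit [Fintype ι] [DecidableEq ι] in
/-- `delN` commutes with unions. [this work] -/
theorem delN_union (N : Finset ι) (X Y : Set (Set ι)) : delN N (X ∪ Y) = delN N X ∪ delN N Y := rfl

omit [Fintype ι] [DecidableEq ι] in
/-- `delN N X ⊆ X` for an up-set `X`. [this work] -/
theorem delN_subset (N : Finset ι) {X : Set (Set ι)} (hX : IsUpperSet X) : delN N X ⊆ X :=
  fun _ hω => hX Set.sdiff_subset hω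

omit [Fintype ι] [DecidableEq ι] in
/-- Nothing meets `N` after `N` is switched off. [this work] -/
theorem delN_hit (N : Finset ι) : delN N (hit N) = ∅ := by
  ext ω
  simp only [Set.mem_empty_iff_false, iff_false]
  rintro ⟨x, hxN, hx⟩
  exact hx.2 (Finset.mem_coe.2 hxN)

omit [Fintype ι] [DecidableEq ι] in
/-- `delN N X` is determined by the coordinates outside `N`. [this work] -/
theorem determinedBy_delN (N : Finset ι) (X : Set (Set ι)) : DeterminedBy (delN N X) (↑N : Set ι)ᶜ := by
  rw [determinedBy_iff]
  intro ω ω' h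
  have hdel : ω \ (↑N : Set ι) = ω' \ (↑N : Set ι) := by
    ext x
    have key := Set.ext_iff.1 h x
    simp only [Set.mem_inter_iff, Set.mem_compl_iff, Finset.mem_coe] at key
    simp only [Set.mem_sdiff, Finset.mem_coe]
    constructor
    · rintro ⟨h1, h2⟩; exact ⟨(key.1 ⟨h1, h2⟩).1, h2⟩
    · rintro ⟨h1, h2⟩; exact ⟨(key.2 ⟨h1, h2⟩).1, h2⟩
  simp only [delN, Set.mem_setOf_eq, hdel]

omit [Fintype ι] [DecidableEq ι] in
/-- The complement of `hit N` ("`N` missed") is determined by `N`. [this work] -/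
theorem determinedBy_hit_compl (N : Finset ι) : DeterminedBy (hit N)ᶜ (↑N : Set ι) := by
  rw [determinedBy_iff]
  intro ω ω' h
  have key : ∀ x ∈ N, x ∈ ω ↔ x ∈ ω' := fun x hx =>
    ⟨fun hω => ((Set.ext_iff.1 h x).1 ⟨hω, Finset.mem_coe.2 hx⟩).1,
     fun hω' => ((Set.ext_iff.1 h x).2 ⟨hω', Finset.mem_coe.2 hx⟩).1⟩
  simp only [hit, Set.mem_compl_iff, Set.mem_setOf_eq, not_exists, not_and]
  exact ⟨fun h1 x hx hω' => h1 x hx ((key x hx).2 hω'), fun h1 x hx hω => h1 x hx ((key x hx).1 hω)⟩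

omit [Fintype ι] [DecidableEq ι] in
/-- The probability of missing `N`. [this work] -/
theorem real_hit_compl (N : Finset ι) : (prodBernoulli p).real (hit N)ᶜ = ∏ x ∈ N, (1 - (p x : ℝ)) := by
  rw [← prodBernoulli_real_forall_notMem p N]
  congr 1
  ext ω
  simp only [hit, Set.mem_compl_iff, Set.mem_setOf_eq, not_exists, not_and]

omit [DecidableEq ι] in
/-- **Switching `N` off**: `μ(X ∩ (hit N)ᶜ) = μ((hit N)ᶜ) · μ(delN N X)` (independence of `N` and its complement). [this work] -/
theorem real_inter_hit_compl (N : Finset ι) (X : Set (Set ι)) :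
    (prodBernoulli p).real (X ∩ (hit N)ᶜ) = (prodBernoulli p).real (hit N)ᶜ * (prodBernoulli p).real (delN N X) := by
  have hset : X ∩ (hit N)ᶜ = (hit N)ᶜ ∩ delN N X := by
    ext ω
    simp only [Set.mem_inter_iff, Set.mem_compl_iff, hit, delN, Set.mem_setOf_eq, not_exists, not_and]
    constructor
    · rintro ⟨hX, hmiss⟩
      refine ⟨hmiss, ?_⟩
      have : ω \ (↑N : Set ι) = ω := by
        ext x
        simp only [Set.mem_sdiff, Finset.mem_coe, and_iff_left_iff_imp]
        exact fun hx hxN => hmiss x hxN hx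
      rw [this]; exact hX
    · rintro ⟨hmiss, hX⟩
      refine ⟨?_, hmiss⟩
      have : ω \ (↑N : Set ι) = ω := by
        ext x
        simp only [Set.mem_sdiff, Finset.mem_coe, and_iff_left_iff_imp]
        exact fun hx hxN => hmiss x hxN hx
      rw [this] at hX; exact hX
  rw [hset]
  exact prodBernoulli_real_inter_of_determinedBy p N (determinedBy_hit_compl N) (determinedBy_delN N X)
    MeasurableSet.of_discrete MeasurableSet.of_discrete

omit [DecidableEq ι] in
/-- `μ(X) = μ(X ∩ hit N) + μ((hit N)ᶜ) · μ(delN N X)`. [this work] -/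
theorem real_eq_hit_add (N : Finset ι) (X : Set (Set ι)) :
    (prodBernoulli p).real X =
      (prodBernoulli p).real (X ∩ hit N) + (prodBernoulli p).real (hit N)ᶜ * (prodBernoulli p).real (delN N X) := by
  rw [← real_inter_hit_compl p N X, ← Set.sdiff_eq]
  exact (measureReal_inter_add_sdiff (μ := prodBernoulli p) (s := X) (t := hit N) MeasurableSet.of_discrete).symm

/-! ## Hit-conditioned safety -/

/-- **Hit-conditioned safety** of the core `A` with respect to `N`: Lemma A in product form under the conditional law
`μ(· | ω meets N)` — for every finite family of up-sets meeting pairwise inside `A`,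
`∏ μ(V_i ∩ hit N) ≤ μ(A ∩ hit N)^(n−1) · μ(hit N)`. [conjecture-shaped hypothesis, this work] -/
def HitSafe (N : Finset ι) (A : Set (Set ι)) : Prop :=
  ∀ (n : ℕ) (V : Fin n → Set (Set ι)), (∀ i, IsUpperSet (V i)) → (∀ i j, i ≠ j → V i ∩ V j ⊆ A) →
    ∏ i, (prodBernoulli p).real (V i ∩ hit N) ≤
      (prodBernoulli p).real (A ∩ hit N) ^ (n - 1) * (prodBernoulli p).real (hit N)

omit [Fintype ι] [DecidableEq ι] in
/-- The pairwise case of `HitSafe`. [this work] -/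
theorem HitSafe.pair {N : Finset ι} {A : Set (Set ι)} (h : HitSafe p N A) {X Y : Set (Set ι)} (hX : IsUpperSet X)
    (hY : IsUpperSet Y) (hXY : X ∩ Y ⊆ A) :
    (prodBernoulli p).real (X ∩ hit N) * (prodBernoulli p).real (Y ∩ hit N) ≤
      (prodBernoulli p).real (A ∩ hit N) * (prodBernoulli p).real (hit N) := by
  have key := h 2 ![X, Y] (fun i => by fin_cases i <;> assumption) (by
    intro i j hij
    fin_cases i <;> fin_cases j
    · exact absurd rfl hij
    · exact hXY
    · rw [Set.inter_comm]; exact hXY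
    · exact absurd rfl hij)
  rw [Fin.prod_univ_two] at key
  simpa using key

/-! ## Sections at `z` of the attached core -/

/-- The attachment event `{z ∈ ω} ∧ hit N`. [this work] -/
def attachEv (z : ι) (N : Finset ι) : Set (Set ι) := {ω | z ∈ ω} ∩ hit N

omit [Fintype ι] [DecidableEq ι] in
/-- `attachEv` is an up-set. [this work] -/
theorem isUpperSet_attachEv (z : ι) (N : Finset ι) : IsUpperSet (attachEv z N) :=
  IsUpperSet.inter (fun _ _ hle h => hle h) (isUpperSet_hit N)

omit [Fintype ι] [DecidableEq ι] in
/-- With `z` switched on the attachment event is `hit N` (`z ∉ N`); switched off it is empty. [this work] -/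
theorem secOn_secOff_attachEv {z : ι} {N : Finset ι} (hz : z ∉ N) :
    secOn z (attachEv z N) = hit N ∧ secOff z (attachEv z N) = ∅ := by
  constructor
  · ext ω
    simp only [secOn, attachEv, hit, Set.mem_setOf_eq, Set.mem_inter_iff, Set.mem_insert_iff, true_or, true_and]
    constructor
    · rintro ⟨x, hxN, rfl | hx⟩
      · exact absurd hxN hz
      · exact ⟨x, hxN, hx⟩
    · rintro ⟨x, hxN, hx⟩; exact ⟨x, hxN, Or.inr hx⟩
  · ext ω
    simp only [secOff, attachEv, Set.mem_setOf_eq, Set.mem_inter_iff, Set.mem_sdiff, Set.mem_singleton_iff,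
      not_true_eq_false, and_false, false_and, Set.mem_empty_iff_false]

/-- An event not depending on `z` equals both its sections at `z`. [this work] -/
theorem secOn_secOff_of_determinedBy {z : ι} {A : Set (Set ι)} (hd : DeterminedBy A (↑(univ.erase z : Finset ι) : Set ι)) :
    secOn z A = A ∧ secOff z A = A := by
  constructor
  · ext ω; exact (determinedBy_iff A _).1 hd (insert z ω) ω (insert_inter_erase z ω)
  · ext ω; exact (determinedBy_iff A _).1 hd (ω \ {z}) ω (diff_inter_erase z ω)

end Attach

end SafeCalc

end Summit.CriticalPhenomena.PercolationContinuityZ3.Theorems.SunflowerPartition
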